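import Mathlib
import HarnessLib
import Literature.MathematicalPhysics.StatisticalMechanics.WeightedNormBounds
import Summits.HubbardSuperconductivity.HubbardSuperconductivity.Theorems.ComplexGFFStiffnessHypACumulantHolomorphicDifferences
import Summits.HubbardSuperconductivity.HubbardSuperconductivity.Theorems.ComplexGFFStiffnessHypACumulantHolomorphicFamilies

/-!
# Crux `HypACumulant`, line `gnv` — Lipschitz and parallelogram bounds of the TAYLOR NORMS
# `‖·‖_{T_φ}` along holomorphic families, from a sup bound alone

Route `route-HubbardSuperconductivity-ComplexGFFStiffness`, cruxes stmt-HubbardSuperconductivity-19154 /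
-19155, shared research statement `OnePointLipschitz`, census (C3d′): the bridge from the two engines
(`…HolomorphicDifferences`: Schwarz lemma; `…HolomorphicFamilies`: Taylor coefficients of a holomorphic
family are holomorphic) to the tree's norms (`GradientRG.tayNorm`, `TayNormLE`, [ABKM19] Def. 13.7 /
(6.46)–(6.48)).  For a family of field functionals `K_σ : E → ℂ` indexed by a complex parameter `σ`
in the disc `|σ| < R`, jointly `C^∞` in `(σ, φ)` and holomorphic in `σ`, a UNIFORM bound
`‖K_σ‖_{T_φ} ≤ M` on the disc gives

* **`tayNorm_sub_le_of_holomorphic`** — `‖K_σ − K_0‖_{T_φ} ≤ (r₀+1)·(2M/R)·|σ|`;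
* **`tayNorm_secondDiff_le_of_holomorphic`** — for a two-parameter family on the bidisc,
  `‖K_{σ,τ} − K_{σ,0} − K_{0,τ} + K_{0,0}‖_{T_φ} ≤ (r₀+1)·(4M/R²)·|σ|·|τ|`;
* `TayNormLE` forms `tayNormLE_sub_of_holomorphic`, `tayNormLE_secondDiff_of_holomorphic` (weight `w`).

Application (next generations): with `(H + σU, K + σV)` in place of `σ` and the renormalisation map in
place of `K_σ`, the zeroth-order bound of [ABKM19] Theorem 6.8 on the complex `(H,K)`-ball yields the
Lipschitz constants and the parallelogram second differences of `S_k`, `A_k`, `B_k` in `(H, K)` with no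
second-difference chain.  Pure analysis; nothing here is specific to the model.  All proved, no `sorry`.

## References
* S. Adams, S. Buchholz, R. Kotecký, S. Müller, arXiv:1910.13564, Definition 13.7, (6.46)–(6.48), Ch. 10–11
  [AdamsBuchholzKoteckyMuller2019].
-/

noncomputable section

-- `Summit.<Summit>.<Problem>`: single-conjunct summit, the duplicate component is mandated (D-0017).
set_option linter.dupNamespace false

namespace Summit.HubbardSuperconductivity.HubbardSuperconductivity.Theorems.ComplexGFF

open Metric Set Finset
open Literature.MathematicalPhysics.StatisticalMechanics.GradientRG

variable {E V : Type*} [NormedAddCommGroup E] [NormedSpace ℝ E] [FiniteDimensional ℝ E]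
  [NormedAddCommGroup V] [NormedSpace ℝ V]

omit [FiniteDimensional ℝ E] in
/-- a single term of the Taylor norm is bounded by it: `‖D^s F̄(Tφ)‖ ≤ s!·‖F‖_{T_φ}` for `s ≤ r₀`. -/
theorem norm_iteratedFDeriv_gaugeLift_le_factorial_mul_tayNorm (T : E →ₗ[ℝ] V) (r₀ : ℕ) (F : E → ℂ) (φ : E)
    {s : ℕ} (hs : s ≤ r₀) :
    ‖iteratedFDeriv ℝ s (gaugeLift T F) (T.rangeRestrict φ)‖ ≤ (s.factorial : ℝ) * tayNorm T r₀ F φ := by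
  have hmem : s ∈ Finset.range (r₀ + 1) := Finset.mem_range.mpr (Nat.lt_succ_of_le hs)
  have hle : ((s.factorial : ℝ)⁻¹) * ‖iteratedFDeriv ℝ s (gaugeLift T F) (T.rangeRestrict φ)‖ ≤ tayNorm T r₀ F φ := by
    unfold tayNorm
    exact Finset.single_le_sum (f := fun s => ((s.factorial : ℝ)⁻¹) * ‖iteratedFDeriv ℝ s (gaugeLift T F) (T.rangeRestrict φ)‖)
      (fun i _ => mul_nonneg (inv_nonneg.2 (Nat.cast_nonneg _)) (norm_nonneg _)) hmem
  have hfac : (0 : ℝ) < s.factorial := by exact_mod_cast s.factorial_pos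
  calc ‖iteratedFDeriv ℝ s (gaugeLift T F) (T.rangeRestrict φ)‖
      = (s.factorial : ℝ) * (((s.factorial : ℝ)⁻¹) * ‖iteratedFDeriv ℝ s (gaugeLift T F) (T.rangeRestrict φ)‖) := by
        field_simp
    _ ≤ (s.factorial : ℝ) * tayNorm T r₀ F φ := mul_le_mul_of_nonneg_left hle hfac.le

/-- **Lipschitz bound of the Taylor norm along a holomorphic family.**  `K : ℂ → E → ℂ` jointly `C^∞`,
`σ ↦ K σ ψ` holomorphic on the disc `|σ| < R` for every field `ψ`, and `‖K σ‖_{T_φ} ≤ M` on the disc: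
then `‖K σ − K 0‖_{T_φ} ≤ (r₀+1)·(2M/R)·|σ|`. -/
theorem tayNorm_sub_le_of_holomorphic (T : E →ₗ[ℝ] V) (r₀ : ℕ) {K : ℂ → E → ℂ} {R M : ℝ}
    (hK : ContDiff ℝ (⊤ : WithTop ℕ∞) (fun p : ℂ × E => K p.1 p.2))
    (hhol : ∀ ψ : E, DifferentiableOn ℂ (fun σ => K σ ψ) (ball (0 : ℂ) R))
    (φ : E) (hM : ∀ σ ∈ ball (0 : ℂ) R, tayNorm T r₀ (K σ) φ ≤ M) {σ : ℂ} (hσ : σ ∈ ball (0 : ℂ) R) :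
    tayNorm T r₀ (fun ψ => K σ ψ - K 0 ψ) φ ≤ ((r₀ : ℝ) + 1) * (2 * M / R) * ‖σ‖ := by
  have hR : 0 < R := lt_of_le_of_lt (norm_nonneg σ) (mem_ball_zero_iff.mp hσ)
  have h0 : (0 : ℂ) ∈ ball (0 : ℂ) R := mem_ball_self hR
  have hM0 : 0 ≤ M := le_trans (tayNorm_nonneg T r₀ (K 0) φ) (hM 0 h0)
  -- the lifted family `F(σ, w) = K σ (section w)` is jointly smooth and holomorphic in `σ`
  set F : ℂ × LinearMap.range T → ℂ := fun p => K p.1 (gaugeSection T p.2) with hF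
  have hFs : ContDiff ℝ (⊤ : WithTop ℕ∞) F :=
    hK.comp (contDiff_fst.prodMk ((gaugeSectionCLM T).contDiff.comp contDiff_snd))
  have hFh : ∀ w : LinearMap.range T, DifferentiableOn ℂ (fun σ => F (σ, w)) (ball (0 : ℂ) R) := fun w => by
    simpa [hF] using hhol (gaugeSection T w)
  have hlift : ∀ σ : ℂ, gaugeLift T (K σ) = fun w => F (σ, w) := fun σ => rfl
  have hKσ : ∀ σ : ℂ, ContDiff ℝ (⊤ : WithTop ℕ∞) (gaugeLift T (K σ)) := fun σ => by
    rw [hlift]; exact hFs.comp ((contDiff_const (c := σ)).prodMk contDiff_id)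
  set w₀ : LinearMap.range T := T.rangeRestrict φ with hw₀
  -- each Taylor coefficient: holomorphic in `σ`, bounded by `s!·M·Π‖v_i‖`, hence Lipschitz (Schwarz)
  have hcoef : ∀ s : ℕ, s ≤ r₀ → ∀ v : Fin s → LinearMap.range T,
      ‖iteratedFDeriv ℝ s (gaugeLift T (K σ)) w₀ v - iteratedFDeriv ℝ s (gaugeLift T (K 0)) w₀ v‖
        ≤ 2 * ((s.factorial : ℝ) * M * ∏ i, ‖v i‖) / R * ‖σ‖ := by
    intro s hs v
    obtain ⟨-, hhol_s⟩ := differentiableOn_iteratedFDeriv_apply_of_holomorphic isOpen_ball hFs hFh s v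
    have hd : DifferentiableOn ℂ (fun σ' => iteratedFDeriv ℝ s (fun w => F (σ', w)) w₀ v) (ball (0 : ℂ) R) := hhol_s w₀
    have hb : ∀ σ' ∈ ball (0 : ℂ) R, ‖iteratedFDeriv ℝ s (fun w => F (σ', w)) w₀ v‖ ≤ (s.factorial : ℝ) * M * ∏ i, ‖v i‖ := by
      intro σ' hσ'
      rw [← hlift]
      calc ‖iteratedFDeriv ℝ s (gaugeLift T (K σ')) w₀ v‖
          ≤ ‖iteratedFDeriv ℝ s (gaugeLift T (K σ')) w₀‖ * ∏ i, ‖v i‖ := ContinuousMultilinearMap.le_opNorm _ _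
        _ ≤ ((s.factorial : ℝ) * tayNorm T r₀ (K σ') φ) * ∏ i, ‖v i‖ :=
            mul_le_mul_of_nonneg_right (norm_iteratedFDeriv_gaugeLift_le_factorial_mul_tayNorm T r₀ (K σ') φ hs)
              (Finset.prod_nonneg fun i _ => norm_nonneg _)
        _ ≤ ((s.factorial : ℝ) * M) * ∏ i, ‖v i‖ :=
            mul_le_mul_of_nonneg_right (mul_le_mul_of_nonneg_left (hM σ' hσ') (Nat.cast_nonneg _))
              (Finset.prod_nonneg fun i _ => norm_nonneg _)
    have h := norm_sub_le_of_bound_ball hd hb hσ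
    rw [← hlift, ← hlift] at h
    exact h
  -- the operator norms of the coefficients of the difference
  have hop : ∀ s : ℕ, s ≤ r₀ →
      ‖iteratedFDeriv ℝ s (gaugeLift T (fun ψ => K σ ψ - K 0 ψ)) w₀‖ ≤ 2 * ((s.factorial : ℝ) * M) / R * ‖σ‖ := by
    intro s hs
    have e : gaugeLift T (fun ψ => K σ ψ - K 0 ψ) = gaugeLift T (K σ) - gaugeLift T (K 0) := rfl
    have hs' : (s : WithTop ℕ∞) ≤ ⊤ := le_top
    rw [e, iteratedFDeriv_sub_apply ((hKσ σ).of_le hs').contDiffAt ((hKσ 0).of_le hs').contDiffAt]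
    refine ContinuousMultilinearMap.opNorm_le_bound (by positivity) (fun v => ?_)
    rw [sub_apply]
    calc ‖iteratedFDeriv ℝ s (gaugeLift T (K σ)) w₀ v - iteratedFDeriv ℝ s (gaugeLift T (K 0)) w₀ v‖
        ≤ 2 * ((s.factorial : ℝ) * M * ∏ i, ‖v i‖) / R * ‖σ‖ := hcoef s hs v
      _ = 2 * ((s.factorial : ℝ) * M) / R * ‖σ‖ * ∏ i, ‖v i‖ := by ring
  -- sum over the orders
  unfold tayNorm
  calc ∑ s ∈ Finset.range (r₀ + 1), ((s.factorial : ℝ)⁻¹) * ‖iteratedFDeriv ℝ s (gaugeLift T (fun ψ => K σ ψ - K 0 ψ)) w₀‖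
      ≤ ∑ s ∈ Finset.range (r₀ + 1), (2 * M / R * ‖σ‖) := by
        refine Finset.sum_le_sum (fun s hs => ?_)
        have hs' : s ≤ r₀ := Nat.lt_succ_iff.mp (Finset.mem_range.mp hs)
        have hfac : (0 : ℝ) < s.factorial := by exact_mod_cast s.factorial_pos
        calc ((s.factorial : ℝ)⁻¹) * ‖iteratedFDeriv ℝ s (gaugeLift T (fun ψ => K σ ψ - K 0 ψ)) w₀‖
            ≤ ((s.factorial : ℝ)⁻¹) * (2 * ((s.factorial : ℝ) * M) / R * ‖σ‖) :=
              mul_le_mul_of_nonneg_left (hop s hs') (inv_nonneg.2 hfac.le)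
          _ = 2 * M / R * ‖σ‖ := by field_simp
    _ = ((r₀ : ℝ) + 1) * (2 * M / R) * ‖σ‖ := by
        rw [Finset.sum_const, Finset.card_range, nsmul_eq_mul]
        push_cast
        ring

/-- **Parallelogram bound of the Taylor norm along a two-parameter holomorphic family.**
`K : ℂ → ℂ → E → ℂ` with `(σ, ψ) ↦ K σ τ ψ` and `(τ, ψ) ↦ K σ τ ψ` jointly `C^∞`, separately holomorphic in
`σ` and in `τ` on the bidisc `|σ|, |τ| < R` for every field, and `‖K σ τ‖_{T_φ} ≤ M` there: then
`‖K σ τ − K σ 0 − K 0 τ + K 0 0‖_{T_φ} ≤ (r₀+1)·(4M/R²)·|σ|·|τ|`. -/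
theorem tayNorm_secondDiff_le_of_holomorphic (T : E →ₗ[ℝ] V) (r₀ : ℕ) {K : ℂ → ℂ → E → ℂ} {R M : ℝ}
    (hKσ : ∀ τ : ℂ, ContDiff ℝ (⊤ : WithTop ℕ∞) (fun p : ℂ × E => K p.1 τ p.2))
    (hKτ : ∀ σ : ℂ, ContDiff ℝ (⊤ : WithTop ℕ∞) (fun p : ℂ × E => K σ p.1 p.2))
    (hholσ : ∀ τ ∈ ball (0 : ℂ) R, ∀ ψ : E, DifferentiableOn ℂ (fun σ => K σ τ ψ) (ball (0 : ℂ) R))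
    (hholτ : ∀ σ ∈ ball (0 : ℂ) R, ∀ ψ : E, DifferentiableOn ℂ (fun τ => K σ τ ψ) (ball (0 : ℂ) R))
    (φ : E) (hM : ∀ σ ∈ ball (0 : ℂ) R, ∀ τ ∈ ball (0 : ℂ) R, tayNorm T r₀ (K σ τ) φ ≤ M)
    {σ τ : ℂ} (hσ : σ ∈ ball (0 : ℂ) R) (hτ : τ ∈ ball (0 : ℂ) R) :
    tayNorm T r₀ (fun ψ => K σ τ ψ - K σ 0 ψ - K 0 τ ψ + K 0 0 ψ) φ
      ≤ ((r₀ : ℝ) + 1) * (4 * M / R ^ 2) * ‖σ‖ * ‖τ‖ := by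
  have hR : 0 < R := lt_of_le_of_lt (norm_nonneg σ) (mem_ball_zero_iff.mp hσ)
  have h0 : (0 : ℂ) ∈ ball (0 : ℂ) R := mem_ball_self hR
  have hM0 : 0 ≤ M := le_trans (tayNorm_nonneg T r₀ (K 0 0) φ) (hM 0 h0 0 h0)
  set w₀ : LinearMap.range T := T.rangeRestrict φ with hw₀
  -- lifted families
  have hlift : ∀ σ τ : ℂ, gaugeLift T (K σ τ) = fun w => K σ τ (gaugeSection T w) := fun σ τ => rfl
  have hFσ : ∀ τ : ℂ, ContDiff ℝ (⊤ : WithTop ℕ∞) (fun p : ℂ × LinearMap.range T => K p.1 τ (gaugeSection T p.2)) :=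
    fun τ => (hKσ τ).comp (contDiff_fst.prodMk ((gaugeSectionCLM T).contDiff.comp contDiff_snd))
  have hFτ : ∀ σ : ℂ, ContDiff ℝ (⊤ : WithTop ℕ∞) (fun p : ℂ × LinearMap.range T => K σ p.1 (gaugeSection T p.2)) :=
    fun σ => (hKτ σ).comp (contDiff_fst.prodMk ((gaugeSectionCLM T).contDiff.comp contDiff_snd))
  have hKc : ∀ σ τ : ℂ, ContDiff ℝ (⊤ : WithTop ℕ∞) (gaugeLift T (K σ τ)) := fun σ τ => by
    rw [hlift]; exact (hFσ τ).comp ((contDiff_const (c := σ)).prodMk contDiff_id)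
  -- coefficient-wise bound via the bidisc Schwarz estimate
  have hcoef : ∀ s : ℕ, s ≤ r₀ → ∀ v : Fin s → LinearMap.range T,
      ‖iteratedFDeriv ℝ s (gaugeLift T (K σ τ)) w₀ v - iteratedFDeriv ℝ s (gaugeLift T (K σ 0)) w₀ v
        - iteratedFDeriv ℝ s (gaugeLift T (K 0 τ)) w₀ v + iteratedFDeriv ℝ s (gaugeLift T (K 0 0)) w₀ v‖
        ≤ 4 * ((s.factorial : ℝ) * M * ∏ i, ‖v i‖) / R ^ 2 * ‖σ‖ * ‖τ‖ := by
    intro s hs v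
    set g : ℂ → ℂ → ℂ := fun σ' τ' => iteratedFDeriv ℝ s (gaugeLift T (K σ' τ')) w₀ v with hg
    have hds : ∀ τ' ∈ ball (0 : ℂ) R, DifferentiableOn ℂ (fun σ' => g σ' τ') (ball (0 : ℂ) R) := by
      intro τ' hτ'
      obtain ⟨-, hh⟩ := differentiableOn_iteratedFDeriv_apply_of_holomorphic isOpen_ball (hFσ τ')
        (fun w => by simpa using hholσ τ' hτ' (gaugeSection T w)) s v
      simpa [hg, hlift] using hh w₀
    have hdt : ∀ σ' ∈ ball (0 : ℂ) R, DifferentiableOn ℂ (g σ') (ball (0 : ℂ) R) := by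
      intro σ' hσ'
      obtain ⟨-, hh⟩ := differentiableOn_iteratedFDeriv_apply_of_holomorphic isOpen_ball (hFτ σ')
        (fun w => by simpa using hholτ σ' hσ' (gaugeSection T w)) s v
      simpa [hg, hlift] using hh w₀
    have hb : ∀ σ' ∈ ball (0 : ℂ) R, ∀ τ' ∈ ball (0 : ℂ) R, ‖g σ' τ'‖ ≤ (s.factorial : ℝ) * M * ∏ i, ‖v i‖ := by
      intro σ' hσ' τ' hτ'
      calc ‖iteratedFDeriv ℝ s (gaugeLift T (K σ' τ')) w₀ v‖
          ≤ ‖iteratedFDeriv ℝ s (gaugeLift T (K σ' τ')) w₀‖ * ∏ i, ‖v i‖ := ContinuousMultilinearMap.le_opNorm _ _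
        _ ≤ ((s.factorial : ℝ) * tayNorm T r₀ (K σ' τ') φ) * ∏ i, ‖v i‖ :=
            mul_le_mul_of_nonneg_right (norm_iteratedFDeriv_gaugeLift_le_factorial_mul_tayNorm T r₀ (K σ' τ') φ hs)
              (Finset.prod_nonneg fun i _ => norm_nonneg _)
        _ ≤ ((s.factorial : ℝ) * M) * ∏ i, ‖v i‖ :=
            mul_le_mul_of_nonneg_right (mul_le_mul_of_nonneg_left (hM σ' hσ' τ' hτ') (Nat.cast_nonneg _))
              (Finset.prod_nonneg fun i _ => norm_nonneg _)
    have h := norm_secondDiff_le_of_bound_bidisc hds hdt hb hσ hτ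
    simpa [hg] using h
  have hop : ∀ s : ℕ, s ≤ r₀ →
      ‖iteratedFDeriv ℝ s (gaugeLift T (fun ψ => K σ τ ψ - K σ 0 ψ - K 0 τ ψ + K 0 0 ψ)) w₀‖
        ≤ 4 * ((s.factorial : ℝ) * M) / R ^ 2 * ‖σ‖ * ‖τ‖ := by
    intro s hs
    have e : gaugeLift T (fun ψ => K σ τ ψ - K σ 0 ψ - K 0 τ ψ + K 0 0 ψ)
        = gaugeLift T (K σ τ) - gaugeLift T (K σ 0) - gaugeLift T (K 0 τ) + gaugeLift T (K 0 0) := rfl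
    have hs' : (s : WithTop ℕ∞) ≤ ⊤ := le_top
    have c1 : ContDiffAt ℝ (s : WithTop ℕ∞) (gaugeLift T (K σ τ)) w₀ := ((hKc σ τ).of_le hs').contDiffAt
    have c2 : ContDiffAt ℝ (s : WithTop ℕ∞) (gaugeLift T (K σ 0)) w₀ := ((hKc σ 0).of_le hs').contDiffAt
    have c3 : ContDiffAt ℝ (s : WithTop ℕ∞) (gaugeLift T (K 0 τ)) w₀ := ((hKc 0 τ).of_le hs').contDiffAt
    have c4 : ContDiffAt ℝ (s : WithTop ℕ∞) (gaugeLift T (K 0 0)) w₀ := ((hKc 0 0).of_le hs').contDiffAt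
    have c12 : ContDiffAt ℝ (s : WithTop ℕ∞) (gaugeLift T (K σ τ) - gaugeLift T (K σ 0)) w₀ := c1.sub c2
    have c123 : ContDiffAt ℝ (s : WithTop ℕ∞) (gaugeLift T (K σ τ) - gaugeLift T (K σ 0) - gaugeLift T (K 0 τ)) w₀ :=
      c12.sub c3
    rw [e, iteratedFDeriv_add_apply c123 c4, iteratedFDeriv_sub_apply c12 c3, iteratedFDeriv_sub_apply c1 c2]
    refine ContinuousMultilinearMap.opNorm_le_bound (by positivity) (fun v => ?_)
    simp only [add_apply, sub_apply]
    calc ‖iteratedFDeriv ℝ s (gaugeLift T (K σ τ)) w₀ v - iteratedFDeriv ℝ s (gaugeLift T (K σ 0)) w₀ v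
          - iteratedFDeriv ℝ s (gaugeLift T (K 0 τ)) w₀ v + iteratedFDeriv ℝ s (gaugeLift T (K 0 0)) w₀ v‖
        ≤ 4 * ((s.factorial : ℝ) * M * ∏ i, ‖v i‖) / R ^ 2 * ‖σ‖ * ‖τ‖ := hcoef s hs v
      _ = 4 * ((s.factorial : ℝ) * M) / R ^ 2 * ‖σ‖ * ‖τ‖ * ∏ i, ‖v i‖ := by ring
  unfold tayNorm
  calc ∑ s ∈ Finset.range (r₀ + 1), ((s.factorial : ℝ)⁻¹) *
        ‖iteratedFDeriv ℝ s (gaugeLift T (fun ψ => K σ τ ψ - K σ 0 ψ - K 0 τ ψ + K 0 0 ψ)) w₀‖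
      ≤ ∑ s ∈ Finset.range (r₀ + 1), (4 * M / R ^ 2 * ‖σ‖ * ‖τ‖) := by
        refine Finset.sum_le_sum (fun s hs => ?_)
        have hs' : s ≤ r₀ := Nat.lt_succ_iff.mp (Finset.mem_range.mp hs)
        have hfac : (0 : ℝ) < s.factorial := by exact_mod_cast s.factorial_pos
        calc ((s.factorial : ℝ)⁻¹) *
              ‖iteratedFDeriv ℝ s (gaugeLift T (fun ψ => K σ τ ψ - K σ 0 ψ - K 0 τ ψ + K 0 0 ψ)) w₀‖
            ≤ ((s.factorial : ℝ)⁻¹) * (4 * ((s.factorial : ℝ) * M) / R ^ 2 * ‖σ‖ * ‖τ‖) :=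
              mul_le_mul_of_nonneg_left (hop s hs') (inv_nonneg.2 hfac.le)
          _ = 4 * M / R ^ 2 * ‖σ‖ * ‖τ‖ := by field_simp
    _ = ((r₀ : ℝ) + 1) * (4 * M / R ^ 2) * ‖σ‖ * ‖τ‖ := by
        rw [Finset.sum_const, Finset.card_range, nsmul_eq_mul]
        push_cast
        ring

/-- **`TayNormLE` form of the Lipschitz bound** (weight `w`): a uniform `TayNormLE T r₀ w (K σ) C` on the
disc gives `TayNormLE T r₀ w (K σ − K 0) ((r₀+1)(2C/R)|σ|)`. -/
theorem tayNormLE_sub_of_holomorphic (T : E →ₗ[ℝ] V) (r₀ : ℕ) (w : E → ℝ) {K : ℂ → E → ℂ} {R C : ℝ}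
    (hK : ContDiff ℝ (⊤ : WithTop ℕ∞) (fun p : ℂ × E => K p.1 p.2))
    (hhol : ∀ ψ : E, DifferentiableOn ℂ (fun σ => K σ ψ) (ball (0 : ℂ) R))
    (hC : ∀ σ ∈ ball (0 : ℂ) R, TayNormLE T r₀ w (K σ) C) {σ : ℂ} (hσ : σ ∈ ball (0 : ℂ) R) :
    TayNormLE T r₀ w (fun ψ => K σ ψ - K 0 ψ) (((r₀ : ℝ) + 1) * (2 * C / R) * ‖σ‖) := by
  intro φ
  have h := tayNorm_sub_le_of_holomorphic T r₀ hK hhol φ (M := C * w φ) (fun σ' hσ' => hC σ' hσ' φ) hσ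
  calc tayNorm T r₀ (fun ψ => K σ ψ - K 0 ψ) φ ≤ ((r₀ : ℝ) + 1) * (2 * (C * w φ) / R) * ‖σ‖ := h
    _ = ((r₀ : ℝ) + 1) * (2 * C / R) * ‖σ‖ * w φ := by ring

/-- **`TayNormLE` form of the parallelogram bound** (weight `w`). -/
theorem tayNormLE_secondDiff_of_holomorphic (T : E →ₗ[ℝ] V) (r₀ : ℕ) (w : E → ℝ) {K : ℂ → ℂ → E → ℂ} {R C : ℝ}
    (hKσ : ∀ τ : ℂ, ContDiff ℝ (⊤ : WithTop ℕ∞) (fun p : ℂ × E => K p.1 τ p.2))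
    (hKτ : ∀ σ : ℂ, ContDiff ℝ (⊤ : WithTop ℕ∞) (fun p : ℂ × E => K σ p.1 p.2))
    (hholσ : ∀ τ ∈ ball (0 : ℂ) R, ∀ ψ : E, DifferentiableOn ℂ (fun σ => K σ τ ψ) (ball (0 : ℂ) R))
    (hholτ : ∀ σ ∈ ball (0 : ℂ) R, ∀ ψ : E, DifferentiableOn ℂ (fun τ => K σ τ ψ) (ball (0 : ℂ) R))
    (hC : ∀ σ ∈ ball (0 : ℂ) R, ∀ τ ∈ ball (0 : ℂ) R, TayNormLE T r₀ w (K σ τ) C)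
    {σ τ : ℂ} (hσ : σ ∈ ball (0 : ℂ) R) (hτ : τ ∈ ball (0 : ℂ) R) :
    TayNormLE T r₀ w (fun ψ => K σ τ ψ - K σ 0 ψ - K 0 τ ψ + K 0 0 ψ)
      (((r₀ : ℝ) + 1) * (4 * C / R ^ 2) * ‖σ‖ * ‖τ‖) := by
  intro φ
  have h := tayNorm_secondDiff_le_of_holomorphic T r₀ hKσ hKτ hholσ hholτ φ (M := C * w φ)
    (fun σ' hσ' τ' hτ' => hC σ' hσ' τ' hτ' φ) hσ hτ
  calc tayNorm T r₀ (fun ψ => K σ τ ψ - K σ 0 ψ - K 0 τ ψ + K 0 0 ψ) φ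
      ≤ ((r₀ : ℝ) + 1) * (4 * (C * w φ) / R ^ 2) * ‖σ‖ * ‖τ‖ := h
    _ = ((r₀ : ℝ) + 1) * (4 * C / R ^ 2) * ‖σ‖ * ‖τ‖ * w φ := by ring

end Summit.HubbardSuperconductivity.HubbardSuperconductivity.Theorems.ComplexGFF

end
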